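import Mathlib.Analysis.SpecialFunctions.Log.Basic
import Mathlib.Analysis.SpecialFunctions.ExpDeriv
import Mathlib.Analysis.Complex.ExponentialBounds

/-!
# The room-temperature thermopower scale of the planar hole concentration in cuprates (Obertelli–Cooper–Tallon; Honma–Hor) and its exact inversion

The second «universal» way — beside the Presland–Tallon parabola (`PreslandTallonParabola.lean`) —
in which a hole concentration `p` per planar Cu is ASSIGNED to a cuprate sample is from its
room-temperature thermoelectric power `S(290 K)` via the empirical Obertelli–Cooper–Tallon (OCT)
scale [ObertelliCooperTallon1992], printed as Eq. (2) of [HonmaEtAl2004, p. 2]: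
```
S₂₉₀ [μV/K] = 372 exp(−32.4 p)   (0.00 < p < 0.05)
            = 992 exp(−38.1 p)   (0.05 < p < 0.155)
            = 24.2 − 139 p       (0.155 < p),
```
and Honma–Hor's own scale, Eq. (3) of [HonmaEtAl2004, p. 4]:
`S₂₉₀ = 392 exp(−19.7 p)` (`0.02 ≤ p ≤ 0.21`), `= 40.5 − 163 p` (`0.21 < p`).

This file makes NO physical claim.  The printed pieces are DEFINITIONS (`octLow`, `octMid`,
`octHigh`, the piecewise `octS290` — the printed intervals are open, we assign the breakpoints to
the piece on their right; `honmaHorMid`, `honmaHorHigh`) and the theorems are the exact algebra a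
user of the scale performs:

* §2 the INVERSE maps (`octMidInv S = log(992/S)/38.1`, `octLowInv`, `octHighInv`) with both round
  trips, and strict monotonicity (each piece is strictly decreasing in `p`);
* §3 ERROR BARS: on the exponential piece an interval `[S₁, S₂]` of measured thermopowers maps to
  the `p`-interval `[octMidInv S₂, octMidInv S₁]`, whose width `log(S₂/S₁)/38.1` is bracketed by
  `(S₂ − S₁)/(38.1 S₂) ≤ · ≤ (S₂ − S₁)/(38.1 S₁)` (`octMidInv_width_bounds`) — i.e. `δp ≈ δS/(38.1 S)`,
  so a `±1 μV/K` uncertainty is `±0.003` in `p` near `p = 0.125` (`S ≈ 8.5`) but the linear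
  overdoped piece gives `δp = δS/139` (`±0.007`); the derivative `dS/dp = −38.1 S` is recorded;
* §4 what the printed piecewise formula does at its breakpoints (located facts about the formula AS
  PRINTED in [HonmaEtAl2004, Eq. (2)], proved with elementary `exp` bounds): at `p = 0.155` the
  exponential and linear pieces agree to within `2.3 %` (`octMid 0.155 ∈ (2.69, 2.72)` vs
  `octHigh 0.155 = 2.655`); at `p = 0.05` they do NOT — the middle piece exceeds the low piece by a
  factor in `(1.9, 2.1)` (`992e^{−1.905}` vs `372e^{−1.62}` μV/K), so a `p` read off near `0.05`
  depends on the piece chosen; Honma–Hor's scale is continuous at `0.21` to within `0.08 μV/K`.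

Not here: any statement that either scale is right for a given family (Honma–Hor argue the OCT
scale misplaces several families; both are CONTEXT conventions for the cell's doping coordinate),
temperature dependence, or the Presland–Tallon parabola (separate file).

References: S. D. Obertelli, J. R. Cooper, J. L. Tallon, Phys. Rev. B 46 (1992) 14928;
T. Honma, P. H. Hor, H. H. Hsieh, M. Tanimoto, Phys. Rev. B 70 (2004) 214517,
arXiv:cond-mat/0309597, Eqs. (2), (3).
AI-produced formalisation (H21, cell hubbard-downfold, seat lit-2, 2026-08-27); no facts, no
axioms beyond Mathlib's, no `sorry`.
-/

namespace Literature.MathematicalPhysics.QuantumLattice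

open Real Set

noncomputable section

/-! ## 1. The printed pieces -/

/-- OCT low-doping piece `S₂₉₀ = 372 exp(−32.4 p)` μV/K (printed range `0 < p < 0.05`).
[cite: HonmaEtAl2004, Eq. (2) (restating ObertelliCooperTallon1992)] -/
def octLow (p : ℝ) : ℝ := 372 * exp (-32.4 * p)

/-- OCT middle piece `S₂₉₀ = 992 exp(−38.1 p)` μV/K (printed range `0.05 < p < 0.155`).
[cite: HonmaEtAl2004, Eq. (2) (restating ObertelliCooperTallon1992)] -/
def octMid (p : ℝ) : ℝ := 992 * exp (-38.1 * p)

/-- OCT overdoped piece `S₂₉₀ = 24.2 − 139 p` μV/K (printed range `0.155 < p`).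
[cite: HonmaEtAl2004, Eq. (2) (restating ObertelliCooperTallon1992)] -/
def octHigh (p : ℝ) : ℝ := 24.2 - 139 * p

/-- The OCT scale as one piecewise function (breakpoints assigned to the right-hand piece).
[cite: HonmaEtAl2004, Eq. (2) (restating ObertelliCooperTallon1992)] -/
def octS290 (p : ℝ) : ℝ :=
  if p < 0.05 then octLow p else if p < 0.155 then octMid p else octHigh p

/-- Honma–Hor exponential piece `S₂₉₀ = 392 exp(−19.7 p)` μV/K (`0.02 ≤ p ≤ 0.21`).
[cite: HonmaEtAl2004, Eq. (3)] -/
def honmaHorMid (p : ℝ) : ℝ := 392 * exp (-19.7 * p)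

/-- Honma–Hor overdoped piece `S₂₉₀ = 40.5 − 163 p` μV/K (`0.21 < p`). [cite: HonmaEtAl2004, Eq. (3)] -/
def honmaHorHigh (p : ℝ) : ℝ := 40.5 - 163 * p

/-- Unfolding. [cite: HonmaEtAl2004, Eq. (2)] -/
theorem octLow_def (p : ℝ) : octLow p = 372 * exp (-32.4 * p) := rfl

/-- Unfolding. [cite: HonmaEtAl2004, Eq. (2)] -/
theorem octMid_def (p : ℝ) : octMid p = 992 * exp (-38.1 * p) := rfl

/-- Unfolding. [cite: HonmaEtAl2004, Eq. (2)] -/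
theorem octHigh_def (p : ℝ) : octHigh p = 24.2 - 139 * p := rfl

/-- Unfolding. [cite: HonmaEtAl2004, Eq. (3)] -/
theorem honmaHorMid_def (p : ℝ) : honmaHorMid p = 392 * exp (-19.7 * p) := rfl

/-- Unfolding. [cite: HonmaEtAl2004, Eq. (3)] -/
theorem honmaHorHigh_def (p : ℝ) : honmaHorHigh p = 40.5 - 163 * p := rfl

/-- The piecewise scale on the middle range. [cite: HonmaEtAl2004, Eq. (2)] -/
theorem octS290_of_mid {p : ℝ} (h₁ : 0.05 ≤ p) (h₂ : p < 0.155) : octS290 p = octMid p := by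
  unfold octS290; rw [if_neg (not_lt.mpr h₁), if_pos h₂]

/-- The piecewise scale on the low range. [cite: HonmaEtAl2004, Eq. (2)] -/
theorem octS290_of_low {p : ℝ} (h : p < 0.05) : octS290 p = octLow p := by
  unfold octS290; rw [if_pos h]

/-- The piecewise scale on the overdoped range. [cite: HonmaEtAl2004, Eq. (2)] -/
theorem octS290_of_high {p : ℝ} (h : 0.155 ≤ p) : octS290 p = octHigh p := by
  unfold octS290
  rw [if_neg (not_lt.mpr (le_trans (by norm_num) h)), if_neg (not_lt.mpr h)]

/-- Every exponential piece is positive. [cite: HonmaEtAl2004, Eq. (2)] -/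
theorem octMid_pos (p : ℝ) : 0 < octMid p := by unfold octMid; positivity

/-- [cite: HonmaEtAl2004, Eq. (2)] -/
theorem octLow_pos (p : ℝ) : 0 < octLow p := by unfold octLow; positivity

/-- The pieces are strictly decreasing in `p`. [cite: HonmaEtAl2004, Eq. (2)] -/
theorem octMid_strictAnti : StrictAnti octMid := by
  intro p q hpq
  unfold octMid
  have : exp (-38.1 * q) < exp (-38.1 * p) := exp_lt_exp.mpr (by linarith)
  linarith

/-- [cite: HonmaEtAl2004, Eq. (2)] -/
theorem octLow_strictAnti : StrictAnti octLow := by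
  intro p q hpq
  unfold octLow
  have : exp (-32.4 * q) < exp (-32.4 * p) := exp_lt_exp.mpr (by linarith)
  linarith

/-- [cite: HonmaEtAl2004, Eq. (2)] -/
theorem octHigh_strictAnti : StrictAnti octHigh := by
  intro p q hpq; unfold octHigh; linarith

/-- [cite: HonmaEtAl2004, Eq. (3)] -/
theorem honmaHorMid_strictAnti : StrictAnti honmaHorMid := by
  intro p q hpq
  unfold honmaHorMid
  have : exp (-19.7 * q) < exp (-19.7 * p) := exp_lt_exp.mpr (by linarith)
  linarith

/-! ## 2. Exact inversion of each piece -/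

/-- `p = log(992/S)/38.1` on the middle piece. [cite: HonmaEtAl2004, Eq. (2)] -/
def octMidInv (S : ℝ) : ℝ := log (992 / S) / 38.1

/-- `p = log(372/S)/32.4` on the low piece. [cite: HonmaEtAl2004, Eq. (2)] -/
def octLowInv (S : ℝ) : ℝ := log (372 / S) / 32.4

/-- `p = (24.2 − S)/139` on the overdoped piece. [cite: HonmaEtAl2004, Eq. (2)] -/
def octHighInv (S : ℝ) : ℝ := (24.2 - S) / 139

/-- `p = log(392/S)/19.7` on Honma–Hor's exponential piece. [cite: HonmaEtAl2004, Eq. (3)] -/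
def honmaHorMidInv (S : ℝ) : ℝ := log (392 / S) / 19.7

/-- Unfolding. [cite: HonmaEtAl2004, Eq. (2)] -/
theorem octMidInv_def (S : ℝ) : octMidInv S = log (992 / S) / 38.1 := rfl

/-- Round trip `p ↦ S ↦ p` on the middle piece. [cite: HonmaEtAl2004, Eq. (2)] -/
theorem octMidInv_octMid (p : ℝ) : octMidInv (octMid p) = p := by
  unfold octMidInv octMid
  rw [show (992 : ℝ) / (992 * exp (-38.1 * p)) = exp (38.1 * p) by
    rw [show (-38.1 : ℝ) * p = -(38.1 * p) by ring, exp_neg]; field_simp]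
  rw [log_exp]; ring

/-- Round trip `S ↦ p ↦ S` on the middle piece (`S > 0`). [cite: HonmaEtAl2004, Eq. (2)] -/
theorem octMid_octMidInv {S : ℝ} (hS : 0 < S) : octMid (octMidInv S) = S := by
  unfold octMid octMidInv
  rw [show (-38.1 : ℝ) * (log (992 / S) / 38.1) = -log (992 / S) by ring, exp_neg,
    exp_log (by positivity)]
  field_simp

/-- Round trip on the low piece. [cite: HonmaEtAl2004, Eq. (2)] -/
theorem octLowInv_octLow (p : ℝ) : octLowInv (octLow p) = p := by
  unfold octLowInv octLow
  rw [show (372 : ℝ) / (372 * exp (-32.4 * p)) = exp (32.4 * p) by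
    rw [show (-32.4 : ℝ) * p = -(32.4 * p) by ring, exp_neg]; field_simp]
  rw [log_exp]; ring

/-- Round trip on the low piece (`S > 0`). [cite: HonmaEtAl2004, Eq. (2)] -/
theorem octLow_octLowInv {S : ℝ} (hS : 0 < S) : octLow (octLowInv S) = S := by
  unfold octLow octLowInv
  rw [show (-32.4 : ℝ) * (log (372 / S) / 32.4) = -log (372 / S) by ring, exp_neg,
    exp_log (by positivity)]
  field_simp

/-- Round trips on the linear piece. [cite: HonmaEtAl2004, Eq. (2)] -/
theorem octHighInv_octHigh (p : ℝ) : octHighInv (octHigh p) = p := by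
  unfold octHighInv octHigh; ring

/-- [cite: HonmaEtAl2004, Eq. (2)] -/
theorem octHigh_octHighInv (S : ℝ) : octHigh (octHighInv S) = S := by
  unfold octHighInv octHigh; ring

/-- Round trip on Honma–Hor's exponential piece. [cite: HonmaEtAl2004, Eq. (3)] -/
theorem honmaHorMidInv_honmaHorMid (p : ℝ) : honmaHorMidInv (honmaHorMid p) = p := by
  unfold honmaHorMidInv honmaHorMid
  rw [show (392 : ℝ) / (392 * exp (-19.7 * p)) = exp (19.7 * p) by
    rw [show (-19.7 : ℝ) * p = -(19.7 * p) by ring, exp_neg]; field_simp]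
  rw [log_exp]; ring

/-- The inverse of the middle piece is strictly decreasing on `S > 0`.
[cite: HonmaEtAl2004, Eq. (2)] -/
theorem octMidInv_strictAntiOn : StrictAntiOn octMidInv (Ioi 0) := by
  intro S₁ h₁ S₂ h₂ h12
  have h₁' : (0 : ℝ) < S₁ := h₁
  have h₂' : (0 : ℝ) < S₂ := h₂
  unfold octMidInv
  have : log (992 / S₂) < log (992 / S₁) :=
    log_lt_log (by positivity) (div_lt_div_of_pos_left (by norm_num) h₁' h12)
  exact div_lt_div_of_pos_right this (by norm_num)

/-! ## 3. Error bars: an interval of thermopowers ↦ an interval of hole concentrations -/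

/-- On the middle piece a measured `S ∈ [S₁, S₂]` (`0 < S₁`) gives `p ∈ [octMidInv S₂, octMidInv S₁]`.
[cite: HonmaEtAl2004, Eq. (2)] -/
theorem octMidInv_mem_Icc {S S₁ S₂ : ℝ} (h₁ : 0 < S₁) (hS : S ∈ Icc S₁ S₂) :
    octMidInv S ∈ Icc (octMidInv S₂) (octMidInv S₁) := by
  obtain ⟨hl, hu⟩ := hS
  have hSpos : 0 < S := lt_of_lt_of_le h₁ hl
  have hS₂ : 0 < S₂ := lt_of_lt_of_le hSpos hu
  exact ⟨octMidInv_strictAntiOn.antitoneOn hSpos hS₂ hu, octMidInv_strictAntiOn.antitoneOn h₁ hSpos hl⟩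

/-- The width of that `p`-interval is `log(S₂/S₁)/38.1`. [cite: HonmaEtAl2004, Eq. (2)] -/
theorem octMidInv_width {S₁ S₂ : ℝ} (h₁ : 0 < S₁) (h₂ : 0 < S₂) :
    octMidInv S₁ - octMidInv S₂ = log (S₂ / S₁) / 38.1 := by
  unfold octMidInv
  rw [log_div (by norm_num) h₁.ne', log_div (by norm_num) h₂.ne', log_div h₂.ne' h₁.ne']
  ring

/-- **Error-bar bracket**: `(S₂ − S₁)/(38.1 S₂) ≤ Δp ≤ (S₂ − S₁)/(38.1 S₁)` for `0 < S₁ ≤ S₂` — the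
usual `δp ≈ δS/(38.1 S)` rule with its two-sided exact form. [cite: HonmaEtAl2004, Eq. (2)] -/
theorem octMidInv_width_bounds {S₁ S₂ : ℝ} (h₁ : 0 < S₁) (h12 : S₁ ≤ S₂) :
    (S₂ - S₁) / (38.1 * S₂) ≤ octMidInv S₁ - octMidInv S₂ ∧
      octMidInv S₁ - octMidInv S₂ ≤ (S₂ - S₁) / (38.1 * S₁) := by
  have h₂ : 0 < S₂ := lt_of_lt_of_le h₁ h12
  rw [octMidInv_width h₁ h₂]
  have hr : 0 < S₂ / S₁ := div_pos h₂ h₁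
  constructor
  · -- `1 − 1/x ≤ log x`
    have hlog : 1 - (S₂ / S₁)⁻¹ ≤ log (S₂ / S₁) := by
      have := Real.one_sub_inv_le_log_of_pos hr
      simpa using this
    have hrew : (S₂ - S₁) / (38.1 * S₂) = (1 - (S₂ / S₁)⁻¹) / 38.1 := by
      field_simp
    rw [hrew]
    exact div_le_div_of_nonneg_right hlog (by norm_num)
  · -- `log x ≤ x − 1`
    have hlog : log (S₂ / S₁) ≤ S₂ / S₁ - 1 := Real.log_le_sub_one_of_pos hr
    have hrew : (S₂ - S₁) / (38.1 * S₁) = (S₂ / S₁ - 1) / 38.1 := by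
      field_simp
    rw [hrew]
    exact div_le_div_of_nonneg_right hlog (by norm_num)

/-- On the linear piece the propagation is exact: `Δp = ΔS/139`. [cite: HonmaEtAl2004, Eq. (2)] -/
theorem octHighInv_width (S₁ S₂ : ℝ) : octHighInv S₁ - octHighInv S₂ = (S₂ - S₁) / 139 := by
  unfold octHighInv; ring

/-- The derivative of the middle piece: `dS/dp = −38.1 S`. [cite: HonmaEtAl2004, Eq. (2)] -/
theorem hasDerivAt_octMid (p : ℝ) : HasDerivAt octMid (-38.1 * octMid p) p := by
  have h : HasDerivAt (fun q : ℝ => 992 * exp (-38.1 * q))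
      (992 * (exp (-38.1 * p) * (-38.1 * 1))) p :=
    (((hasDerivAt_id p).const_mul (-38.1)).exp).const_mul 992
  have heq : 992 * (exp (-38.1 * p) * (-38.1 * 1)) = -38.1 * octMid p := by
    unfold octMid; ring
  rw [← heq]
  exact h

/-! ## 4. The printed breakpoints -/

/-- The linear piece at its breakpoint: `octHigh 0.155 = 2.655` μV/K. [cite: HonmaEtAl2004, Eq. (2)] -/
theorem octHigh_at_breakpoint : octHigh 0.155 = 2.655 := by unfold octHigh; norm_num

/-- The exponential middle piece at `p = 0.155` lies in `(2.69, 2.72)` μV/K: it meets the linear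
piece (`2.655`) to within `2.3 %`. [cite: HonmaEtAl2004, Eq. (2)] -/
theorem octMid_at_upper_breakpoint : 2.69 < octMid 0.155 ∧ octMid 0.155 < 2.72 := by
  have he₁ := Real.exp_one_gt_d9
  have he₂ := Real.exp_one_lt_d9
  have hsplit : octMid 0.155 = 992 * exp 0.0945 / (exp 1) ^ 6 := by
    unfold octMid
    rw [← exp_nat_mul, mul_div_assoc, ← exp_sub]; norm_num
  have hlo : (1.0945 : ℝ) ≤ exp 0.0945 := by
    have := Real.add_one_le_exp (0.0945 : ℝ); norm_num at this ⊢; linarith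
  have hhi : exp (0.0945 : ℝ) ≤ 1.1044 := by
    have := Real.exp_bound_div_one_sub_of_interval (x := 0.0945) (by norm_num) (by norm_num)
    have h2 : (1 : ℝ) / (1 - 0.0945) ≤ 1.1044 := by norm_num
    linarith
  have hpow_lo : (403.428 : ℝ) ≤ (exp 1) ^ 6 := by
    have : (2.7182818283 : ℝ) ^ 6 ≤ (exp 1) ^ 6 :=
      pow_le_pow_left₀ (by norm_num) he₁.le 6
    have h2 : (403.428 : ℝ) ≤ (2.7182818283 : ℝ) ^ 6 := by norm_num
    linarith
  have hpow_hi : (exp 1) ^ 6 ≤ (403.4289 : ℝ) := by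
    have : (exp 1) ^ 6 ≤ (2.7182818286 : ℝ) ^ 6 :=
      pow_le_pow_left₀ (exp_pos 1).le he₂.le 6
    have h2 : (2.7182818286 : ℝ) ^ 6 ≤ 403.4289 := by norm_num
    linarith
  have hpow_pos : (0 : ℝ) < (exp 1) ^ 6 := by positivity
  rw [hsplit]
  constructor
  · rw [lt_div_iff₀ hpow_pos]; nlinarith
  · rw [div_lt_iff₀ hpow_pos]; nlinarith

/-- **The printed scale jumps at `p = 0.05`**: the middle piece there exceeds the low piece by a
factor strictly between `1.9` and `2.1` (`992 e^{−1.905}` vs `372 e^{−1.62}` μV/K), i.e. the two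
printed exponentials do not join. [cite: HonmaEtAl2004, Eq. (2)] -/
theorem oct_jump_at_lower_breakpoint :
    1.9 * octLow 0.05 < octMid 0.05 ∧ octMid 0.05 < 2.1 * octLow 0.05 := by
  have hratio : octMid 0.05 = (992 / 372 * exp (-0.285)) * octLow 0.05 := by
    unfold octMid octLow
    rw [show (-38.1 : ℝ) * 5e-2 = -0.285 + -32.4 * 5e-2 by norm_num, exp_add]
    field_simp
  have hpos : 0 < octLow 0.05 := octLow_pos _
  have hlo : (0.715 : ℝ) ≤ exp (-0.285) := by
    have := Real.add_one_le_exp (-0.285 : ℝ); norm_num at this ⊢; linarith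
  have hhi : exp (-0.285 : ℝ) ≤ 1 / 1.285 := by
    rw [exp_neg, one_div]
    have h1 : (1.285 : ℝ) ≤ exp 0.285 := by
      have := Real.add_one_le_exp (0.285 : ℝ); norm_num at this ⊢; linarith
    exact inv_anti₀ (by norm_num) h1
  rw [hratio]
  constructor
  · have : (1.9 : ℝ) < 992 / 372 * exp (-0.285) := by nlinarith
    nlinarith
  · have : 992 / 372 * exp (-0.285) < (2.1 : ℝ) := by
      have h3 : (992 : ℝ) / 372 * (1 / 1.285) < 2.1 := by norm_num
      nlinarith
    nlinarith

/-- Hence the piecewise `octS290` is NOT continuous from the left at `0.05`: its value there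
(middle piece) exceeds the left-hand piece's value by more than `1.9×`. [cite: HonmaEtAl2004, Eq. (2)] -/
theorem octS290_at_005 : octS290 0.05 = octMid 0.05 ∧ 1.9 * octLow 0.05 < octS290 0.05 := by
  have h := octS290_of_mid (p := 0.05) le_rfl (by norm_num)
  exact ⟨h, h ▸ oct_jump_at_lower_breakpoint.1⟩

/-- Honma–Hor's two pieces at their breakpoint `p = 0.21`: linear `6.27`, exponential in
`(6.19, 6.32)` μV/K — continuous to within `0.08 μV/K`. [cite: HonmaEtAl2004, Eq. (3)] -/
theorem honmaHor_at_breakpoint :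
    honmaHorHigh 0.21 = 6.27 ∧ 6.19 < honmaHorMid 0.21 ∧ honmaHorMid 0.21 < 6.32 := by
  refine ⟨by unfold honmaHorHigh; norm_num, ?_, ?_⟩
  all_goals
    have he₁ := Real.exp_one_gt_d9
    have he₂ := Real.exp_one_lt_d9
    have hsplit : honmaHorMid 0.21 = 392 * exp (-0.137) / (exp 1) ^ 4 := by
      unfold honmaHorMid
      rw [← exp_nat_mul, mul_div_assoc, ← exp_sub]; norm_num
    have hlo : (0.863 : ℝ) ≤ exp (-0.137) := by
      have := Real.add_one_le_exp (-0.137 : ℝ); norm_num at this ⊢; linarith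
    have hhi : exp (-0.137 : ℝ) ≤ 1 / 1.137 := by
      rw [exp_neg, one_div]
      have h1 : (1.137 : ℝ) ≤ exp 0.137 := by
        have := Real.add_one_le_exp (0.137 : ℝ); norm_num at this ⊢; linarith
      exact inv_anti₀ (by norm_num) h1
    have hpow_lo : (54.598 : ℝ) ≤ (exp 1) ^ 4 := by
      have : (2.7182818283 : ℝ) ^ 4 ≤ (exp 1) ^ 4 := pow_le_pow_left₀ (by norm_num) he₁.le 4
      have h2 : (54.598 : ℝ) ≤ (2.7182818283 : ℝ) ^ 4 := by norm_num
      linarith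
    have hpow_hi : (exp 1) ^ 4 ≤ (54.5982 : ℝ) := by
      have : (exp 1) ^ 4 ≤ (2.7182818286 : ℝ) ^ 4 := pow_le_pow_left₀ (exp_pos 1).le he₂.le 4
      have h2 : (2.7182818286 : ℝ) ^ 4 ≤ 54.5982 := by norm_num
      linarith
    have hpow_pos : (0 : ℝ) < (exp 1) ^ 4 := by positivity
    rw [hsplit]
  · rw [lt_div_iff₀ hpow_pos]; nlinarith
  · rw [div_lt_iff₀ hpow_pos]
    have : 392 * exp (-0.137) ≤ 392 * (1 / 1.137 : ℝ) := by nlinarith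
    nlinarith

end

end Literature.MathematicalPhysics.QuantumLattice
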